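import Summits.QuantumFields.YangMills.Theorems.UnitScaleTiltHalvingHSiteTopOfDatum
import Summits.QuantumFields.YangMills.Theorems.UnitScaleTiltHalvingHSiteSizeRowsOfTopRows
import HarnessLib

/-!
# `hP1room` PROGRAMME (LEAD-H «H = hSupUρ3 ⟸ hMember», «FULL k ≥ 2 → ★w3-19200» 2026-08-28T19:11Z), FILE B₂: ★★★ THE PER-SITE COMPOSER FOR `2 ≤ K − n`
# — `hMember`'s 22-row ∃-BODY VERBATIM at one site, from the Theorem-4 datum socket `hT4`, `SB9`, `SLetτ`, ✓p654113's `H42`∕`H59`, and ★t4-w13's windows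

Route `UnitScaleTilt`, crux K1 child «MinimiserStabilityRegPr» (stmt-QuantumFields-19200), registered stub `stub_halvingStep` (`BirthV10`), displayed text
«H = hMember» (✓p657837 `HalvingHSupURho3OfMemberRows.hSupUρ3_of_memberRows`; HOME `ym-ust-19200-w5/g5/hMember.text.w5g5.lean.txt`).  Cell `ym3-torus`
(HUMAN RULING D-0037: YM₃ on T³ is ladder rung R3 — NOT d = 4, NOT a mass gap, NOT the Clay problem), width seat `ym-ust-19200-w3` gen 8 (H-door lineage).
`--supports stmt-QuantumFields-19200 --as helper`; THEOREMS ONLY (0 `def`, 0 `sorry`); count-neutral; nothing here claims `hMember` ∀-uniformly, `hSupUρ3`, the stub,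
the crux or the gap — the sockets stay DISPLAYED for (K-final).

WHAT (★w3-20520 g6's memo `KSITE-FULL-CALLGRAPH-w3g6.md` §0–§8; the `k ≥ 2` sibling of ★w7-19200 g5's ✓p660425 `siteRows_of_sockets_base`).
★★★ `siteRows_of_sockets (h2 : 2 ≤ K − n)`: under `hMember`'s antecedents at one site (member `(L, ρ, S, M, M′)`, `ρ′ := ρ+M+L+S`, `ε₀`, J3's letter
`s := (198 + 12(M′−1+4ρ′))ε₀`, the room, `U ∈ regFibrePr`, `x₀`, the window letter `t ∈ [0, M′−1]`, corner `a := Bᵏx₀ − t`) and the DISPLAYED data —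
★t4-w13's schedule letters with the windows of Proposition 3 (both radii), of the JOIN, of the family constants and of the torus blocks (★w8's letters
`hσ hδ hω hτ₀ hbudget hm hm₀ hr hCb₀ hCl₀ hwin`, as for ✓`hTorus_base_of_windows`), the size letter `hcsB : c⋆ ≤ Bsz·ε₀`, and the SOCKETS `hT4` (Theorem 4's
datum, ∀ `gJ`; FILE A₂ §2 closes it from the four raw N05∕N06 sockets), `SB9` ([4] Thm 3.3 in Prop. 3's frame at level `K − n − 1`), `SLetτ` ([4] letters),
`H42`∕`H59` (✓p654113's, ∀ `gJ`∕`g′`) — the ∃-BODY of `hMember` VERBATIM.  Witnesses: `gJ u₁ W A κf` from FILE A₂ ✓`siteDatum_of_T4`, `lam` from FILE A₂′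
✓`siteTop_of_datum`, `c₁ := c⋆·L^{−(K−n−1)}`, `c′ := 2·L·c⋆` (✓p652002 `hchartTop_of_hdat`∕`hc₁_of_small`), the sizes `hX1 hX2` from ✓p654113
`siteSizeRows_of_topRows` at `m := K − n − 1`, `Bε := Bsz·ε₀` with the knit clause ✓p655738 `hknit_of_descent`.  Level transport `K − n = m + 1` by `rw` (✓p660425's
`e01` pattern).  LETTER RULE (LEAD-H 2026-08-28T18:39Z) ✓: nothing naming `gJ U′ u₁ W A lam th κf` free.  HONEST SCOPE: by-name composition; nothing of Prop. 3∕5,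
Theorem 4, [4] Thm 3.1∕3.3 or the stub is proved here.

References: T. Bałaban, CMP **99** (1985) 75–102 [Balaban1985RegularSpaces] (Prop. 5 (1.106)–(1.109) p.94, Thm 4 p.88, Prop. 3 (1.36)–(1.42) pp.82–83, (1.57)–(1.59)
p.86, (1.131) p.99, p.98); CMP **99** (1985) 389–434 [Balaban1985BackgroundPropagators] (Thm 3.1 p.397, (3.25) p.394, Thm 3.3 p.398); CMP **102** (1985) 277–309
[Balaban1985Variational] ((150)–(156) pp.301–302); CMP **98** (1985) 17–51 [Balaban1985Averaging] ((19)–(23) pp.20–21, (208)–(214) p.50).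
-/

set_option autoImplicit false

noncomputable section

open scoped BigOperators Matrix.Norms.L2Operator
open NormedSpace
open Complex (I)

namespace Summit.QuantumFields.YangMills.Theorems.HalvingHSiteRowsOfSockets

open Literature.MathematicalPhysics.QuantumFieldTheory.Balaban1983to89
open Literature.MathematicalPhysics.QuantumFieldTheory.Balaban1983to89.T3ContinuumYM3Torus
open Literature.MathematicalPhysics.QuantumFieldTheory.Balaban1983to89.T3PrintedRegularMinimiser (RegPr regFibrePr)
open MatrixLog (mlog)
open B5Eq118OneStroke (iterBlockOf)
open B7Prop1Explicit (e expUnit)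
open B7Prop1Explicit renaming Site → LSite
open B7Prop2Explicit (unitaryUnits C0 c2' avgIter)
open B7Prop2SpecialUnitary (specialUnitaryUnits mem_specialUnitaryUnits specialUnitaryUnits_le_unitaryUnits)
open B7Prop3Flat (c3)
open B7Prop10General (C6 C4G)
open B7Prop9Flat (C5')
open B7Prop1Local (InBox loK bondHiK)
open B7Eq78Linearization (conjR zdBlocking QprimeIter)
open B7Eq92Concrete (mgauge)
open B8Ineq130 (tlo thi)
open B8Ineq132 (covDerivFwd InAk)
open B8Eq119TwistedAxial (Restr129 InAx bgT)
open B8Eq131Cubes (cube gs tLo tHi)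
open B8Eq131CubesAdmissible (cubeFam)
open B8CubeMemberZd (cubeLamS cubeLamB)
open B8Eq184Proof (gaugeExp cfgExp)
open B8Eq182Proof (gAd)
open B8Eq188Proof (frakF3)
open B8Eq140Level (SideTouches)
open B8Eq146AExpansion (iEta)
open B8Eq138LandauZd (IsLandau138W covDivB covLap QT logCfg)
open B7Prop4GeneralLevels (logCovIter linCovIter)
open B8Eq155JBound (Jcur wsup)
open B8ScaledSupNorm (bondNorm msup)
open B8Ineq125Concrete (C2p)
open B8Eq1117Concrete (XSpace)
open B8LeafModelZd3 (SockB9P3)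
open B8Prop5ContractionKLevel (Bd2 Mc Kc)
open B8LambdaSpaceKLevel (wt)
open B8Eq178Averages (Qnl)
open B8SpecialUnitaryTrace (trCLM trCLM_apply)
open B10Eq27TorusAxialLog (transl rel pull pull_apply unitsField toUField suIncl gaugeActT axialT unitsField_mem_unitaryUnits)
open B15Eq112TorusCover (lift cover)
open Node00 (coverAt)
open LatticeFieldCalculus (siteAvgIter)
open Summit.QuantumFields.YangMills.Theorems.Prop8ChartDoubleBar (dbarIterU vframeU)
open P1FlatCoreCubeInclusion (corner_of_offset)
open HalvingP1FlatCoreSupplierAssembly (hchartTop_of_hdat hc₁_of_small)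
open HalvingHSiteSizeRowsOfTopRows (siteSizeRows_of_topRows)
open HalvingHSiteTopKnit (hknit_of_descent)
open HalvingHSiteDatumOfSockets (siteDatum_of_T4)
open HalvingHSiteTopOfDatum (siteTop_of_datum)

variable (F : T3Family) {n K : ℕ}

set_option maxHeartbeats 400000 in
/-- ★★★ **THE PER-SITE COMPOSER FOR `2 ≤ K − n`** — see the module docstring: `hMember`'s 22-row ∃-body VERBATIM at one site from the displayed windows and the
sockets `hT4 SB9 SLetτ H42 H59`. [cite: Balaban1985RegularSpaces, Prop. 5 (1.106)-(1.109) p.94, Thm 4 p.88, Prop. 3 (1.36)-(1.42) pp.82-83, (1.57)-(1.59) p.86, (1.131) p.99; Balaban1985BackgroundPropagators, Thm 3.1 p.397, Thm 3.3 p.398; Balaban1985Variational, (150)-(156) pp.301-302; Balaban1985Averaging, (19)-(23) pp.20-21, (208)-(214) p.50] -/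
theorem siteRows_of_sockets (L : ℕ) (hF : F.L = L) (hnK : n < K) (h2 : 2 ≤ K - n)
    -- `hMember`'s antecedents read at one site
    (ρ S M M' : ℕ) {ρ' : ℕ} (hρ'def : ρ' = ρ + M + L + S) {ε₀ : ℝ} (hε₀ : 0 < ε₀) (hε : 10 ^ 7 * (F.L : ℝ) ^ 3 * ε₀ ≤ 1)
    {s : ℝ} (hsdef : s = (198 + 12 * (((M' : ℝ) - 1) + 4 * ρ')) * ε₀) (hs6 : s ≤ 1 / 6)
    (hroom : 2 * ρ + (M' + 1 + 2 * (M + L + S)) ≤ F.L ^ (F.m + n))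
    (V : GaugeField (F.P n) 0 (Matrix.specialUnitaryGroup (Fin 2) ℂ)) (U : GaugeField (F.P K) 0 (Matrix.specialUnitaryGroup (Fin 2) ℂ))
    (hU : U ∈ regFibrePr F n K hnK.le ε₀ V) (x₀ : Site (F.P K) 0)
    {t : ℤ} (ht0 : 0 ≤ t) (ht : t ≤ (M' : ℤ) - 1)
    {a : LSite (F.P K).d} (hadef : a = fun μ => ((iterBlockOf (K - n) x₀ μ).val : ℤ) - t)
    -- ★t4-w13's schedule letters (`α₀ := ε₀`, `cstar`, `α₄`, `B₀'`; `σ δ ω τ₀ m₀`), the socket constants, the size letter `Bsz`, and the windows of Proposition 3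
    -- (at `(ε₀, c⋆)` and at `(ε₀, 2(L·c⋆) + 8α₄)`), of the JOIN, of the family constants, of the torus blocks, of the trace row — DISPLAYED, free of every ∃-witness
    {α₁ B₀ B₀' cstar α₄ C₂ σ δ ω τ₀ cB cA cDA Cb Cl B₀'H B₂' BG BR B₀β cB9 β Bsz : ℝ} {len : LSite (F.P K).d → ℝ} {m₀ : ℕ}
    (hα₁ : 0 < α₁) (hB₀ : 0 < B₀) (hB₀' : 0 < B₀') (hB₀'H : 0 < B₀'H) (hB₂' : 0 ≤ B₂') (hBG : 0 ≤ BG) (hBR : 0 ≤ BR) (hsα₁ : s ≤ α₁)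
    (hc : cstar = 5 * ((F.P K).d : ℝ) * (F.P K).L * B₀ * (ε₀ + α₁))
    (hα₄ : α₄ = 8 * B₀' * (5 * ((F.P K).d : ℝ) * (F.P K).L * B₀) * (ε₀ + α₁)) (hs₂ : (F.P K).L * cstar ≤ 1 / 12)
    (hside₀ : 36 * (F.P K).d * B₀ * cstar ≤ 1 / 2)
    (hC₂ : 8 * (131072 * (((F.P K).d : ℝ) + 1) ^ 2) * Real.exp (4 * (800 * (((F.P K).d : ℝ) + 1) ^ 2 * (((F.P K).d : ℝ) + 4)) * ε₀) ≤ C₂)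
    (h61₀ : 2 * cstar ^ 2 + 20 * (F.P K).d * ε₀ * cstar + 2 * C₂ * cstar ^ 2 ≤ ε₀ + α₁) (hsmall₁ : ((F.P K).d : ℝ) * (F.P K).L * α₁ ≤ 1 / 8)
    (hα3 : C0 (F.P K).d * ε₀ ≤ 1 / 3) (hα4 : 4 * ε₀ ≤ c2' (F.P K).d (F.P K).L)
    (h16 : 16 * (2 * ((F.P K).L * cstar) + 8 * α₄) ≤ 1) (hd5 : 5 * (2 * ((F.P K).L * cstar) + 8 * α₄) * (((F.P K).d : ℝ) - 1) ≤ 4)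
    (hsmallP : Real.exp (4 * (800 * (((F.P K).d : ℝ) + 1) ^ 2 * (((F.P K).d : ℝ) + 4)) * ε₀)
      * (1 + 8 * (131072 * (((F.P K).d : ℝ) + 1) ^ 2) * (2 * ((F.P K).L * cstar) + 8 * α₄)) ≤ 2)
    (hc₃P : 2 * (2 * ((F.P K).L * cstar) + 8 * α₄) ≤ c3 (F.P K).d (F.P K).L) (hside : 36 * (F.P K).d * B₀ * (2 * ((F.P K).L * cstar) + 8 * α₄) ≤ 1 / 2)
    (h50 : 50 * (F.P K).d * (2 * ((F.P K).L * cstar) + 8 * α₄) ≤ 1)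
    (h61 : 2 * (2 * ((F.P K).L * cstar) + 8 * α₄) ^ 2 + 20 * (F.P K).d * ε₀ * (2 * ((F.P K).L * cstar) + 8 * α₄)
      + 2 * C₂ * (2 * ((F.P K).L * cstar) + 8 * α₄) ^ 2 ≤ ε₀ + α₁)
    (hcBlo : (F.P K).L * cstar ≤ cB) (hcAlo : (F.P K).L * cstar ≤ cA) (hcDAlo : ((F.P K).d : ℝ) * ((F.P K).L : ℝ) ^ 2 * cstar ≤ cDA)
    (hsmall : Real.exp (4 * (800 * (((F.P K).d : ℝ) + 1) ^ 2 * (((F.P K).d : ℝ) + 4)) * ε₀) * (1 + 8 * (131072 * (((F.P K).d : ℝ) + 1) ^ 2) * cB) ≤ 2)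
    (hc₃ : 2 * cB ≤ c3 (F.P K).d (F.P K).L) (hsc : 2048 * ((F.P K).d : ℝ) * cB ≤ 1) (hα₃' : 40 * (F.P K).d * cB ≤ 1 / 200)
    (hs₁ : 200 * C6 (F.P K).d * (2 * α₄) ≤ 1) (hs₂' : 12000 * (((F.P K).d : ℝ) + 1) * (F.P K).L * (2 * α₄) ≤ 1)
    (hs₃ : C4G (F.P K).d (F.P K).L * (ε₀ + 40 * (F.P K).d * cB + 4 * (2 * α₄)) ≤ 1)
    (hs₄ : 1024 * (((F.P K).d : ℝ) + 1) * (((F.P K).d : ℝ) + 4) * (F.P K).L ^ 2 * ε₀ ≤ 1)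
    (hs₅ : 32 * (((F.P K).d : ℝ) + 1) ^ 2 * C6 (F.P K).d * (F.P K).L ^ 2 * ε₀ ≤ 1)
    (hs₆ : 16 * (F.P K).d * C5' (F.P K).d * C6 (F.P K).d * ((F.P K).L : ℝ) ^ 2 * ε₀ ≤ 1) (hs₇ : 8 * (F.P K).d * C6 (F.P K).d * (F.P K).L * ε₀ ≤ 1)
    (hprod8 : 2 * C6 (F.P K).d * (40 * (F.P K).d * cB + 4 * α₄) ≤ 1 / 8)
    (hα70 : α₄ ≤ 1 / 70) (hcA0 : 0 ≤ cA) (hcA12 : cA ≤ 1 / 12) (hcA13 : cA ≤ 1 / 13)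
    (hCblo : C2p (F.P K).d * (40 * (F.P K).d * cB + α₄) * α₄ ≤ Cb) (hCllo : 2 * C2p (F.P K).d * (40 * (F.P K).d * cB + 2 * α₄) ≤ Cl)
    (hCbρ : Cb ≤ α₄ / (2 * B₀'H)) (hClB : Cl * B₀'H ≤ 1 / 2)
    (hσ : 2 * (F.P K).L * cstar ≤ σ)
    (hδ : δ = 8 * ((((F.P K).d + 2) * (F.P K).L : ℕ) : ℝ) * σ) (hω : ω = ((F.P K).d : ℝ) * (F.P K).L * α₄ / 2) (hτ₀ : τ₀ = 16 * m₀ * σ)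
    (hbudget : 8 * 3800 * ((((F.P K).d + 2) * (F.P K).L : ℕ) : ℝ) ^ 2 * σ ≤ 1) (hm : 32 * (m₀ : ℝ) * σ ≤ 1)
    (hm₀ : (F.P K).d * (M' + ρ') ≤ m₀) (hr : 160 * (α₄ + δ + 11 * ω) ≤ 1 / 4)
    (hCb₀ : 640 * (α₄ + δ + 5 * ω) * ω ≤ Cb) (hCl₀ : 10240 * (((F.P K).d : ℝ) * (F.P K).L) * (α₄ + δ + 11 * ω) ≤ Cl)
    (hwin : ∀ τ : ℝ, 0 ≤ τ → τ ≤ τ₀ →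
      B₀'H * τ < α₄ / 4 ∧ α₄ / 4 + B₀'H * (Cb + τ) ≤ 1 / 24 ∧ α₄ / 4 + B₀'H * (Cb + τ) ≤ 1 / 140 ∧
      10 * (α₄ / 4 + B₀'H * (Cb + τ)) * BR ≤ 1 / 2 ∧ B₀'H * (Cb + τ) ≤ 3 * α₄ / 4 ∧
      BG * Mc (F.P K).d BR (α₄ / 4 + B₀'H * (Cb + τ)) cA (B₂' * (Cb + τ)) cDA ≤ α₄ / 4 ∧
      BG * Kc (F.P K).d BR (α₄ / 4 + B₀'H * (Cb + τ)) cA (B₂' * (Cb + τ)) cDA (B₂' * (2 * Cl)) (1 + B₀'H * (2 * Cl)) (1 + B₀'H * (2 * Cl))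
        ≤ 1 / 2)
    (hcsB : cstar ≤ Bsz * ε₀)
    -- SOCKET: Theorem 4's datum at every level for the pre-gauged field, ∀-closed over the member's `SU(2)` gauge (= (τ-D) ✓p654692's conclusion; FILE A₂ §2 `hT4_of_rawSockets`)
    (hT4 : ∀ gJ : GaugeTransf (F.P K) 0 (Matrix.specialUnitaryGroup (Fin 2) ℂ),
      InAk (F.P K).L (K - n) (((F.L : ℝ)⁻¹) ^ (K - n)) ε₀ (fun _ => (Set.univ : Set (LSite (F.P K).d))) (pull (unitsField (toUField (GaugeField.gaugeAct gJ U))) 0) →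
      (∀ (x : LSite (F.P K).d) (ν : Fin (F.P K).d), tlo (F.P K).L (tLo a ρ') (K - n) ≤ x → x + e ν ≤ thi (F.P K).L (tHi a M' ρ') (K - n) →
        ‖((pull (unitsField (toUField (GaugeField.gaugeAct gJ U))) 0 x ν : (Matrix (Fin 2) (Fin 2) ℂ)ˣ) : Matrix (Fin 2) (Fin 2) ℂ) - 1‖ < s) →
      ∀ m, m ≤ K - n → ∃ u : LSite (F.P K).d → (Matrix (Fin 2) (Fin 2) ℂ)ˣ,
        (∀ x, ((u x : (Matrix (Fin 2) (Fin 2) ℂ)ˣ) : Matrix (Fin 2) (Fin 2) ℂ) ∈ Matrix.specialUnitaryGroup (Fin 2) ℂ) ∧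
        Restr129 (F.P K).L m (cubeLamS (F.P K).L a M' ρ' (K - n) m) (1 : LSite (F.P K).d → Fin (F.P K).d → (Matrix (Fin 2) (Fin 2) ℂ)ˣ) u ∧
        ∃ W : LSite (F.P K).d → Fin (F.P K).d → (Matrix (Fin 2) (Fin 2) ℂ)ˣ,
          mgauge (1 : LSite (F.P K).d → Fin (F.P K).d → (Matrix (Fin 2) (Fin 2) ℂ)ˣ) u W = pull (unitsField (toUField (GaugeField.gaugeAct gJ U))) 0 ∧
          (1 ≤ m → IsLandau138W (F.P K).L m (((F.L : ℝ)⁻¹) ^ (K - n)) (cubeFam false (F.P K).L a M' ρ' (K - n) 0) (cubeLamS (F.P K).L a M' ρ' (K - n) m)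
            (1 : LSite (F.P K).d → Fin (F.P K).d → (Matrix (Fin 2) (Fin 2) ℂ)ˣ) W) ∧
          ∃ A : LSite (F.P K).d → Fin (F.P K).d → Matrix (Fin 2) (Fin 2) ℂ, ∀ j, j ≤ m →
            ∀ b ∈ {b : LSite (F.P K).d × Fin (F.P K).d | SideTouches (cubeFam false (F.P K).L a M' ρ' (K - n) j) b.1 b.2},
              W b.1 b.2 = cfgExp (((F.L : ℝ)⁻¹) ^ (K - n)) A b.1 b.2 ∧ IsSelfAdjoint (A b.1 b.2) ∧
                ‖A b.1 b.2‖ ≤ cstar * (((F.P K).L : ℝ) ^ j * ((F.L : ℝ)⁻¹) ^ (K - n))⁻¹)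
    -- SOCKET: the b9 in-edge in Proposition 3's frame AT LEVEL `K − n − 1` (lit `SockB9P3` at `M₂(ℂ)`, explicit instance) and its threshold
    (SB9 : @SockB9P3 (F.P K).d (Matrix (Fin 2) (Fin 2) ℂ) (B10Eq29TubeLine.cstarAlgebraMatrix 2) (F.P K).L B₀ B₀β cB9 β len (((F.L : ℝ)⁻¹) ^ (K - n)) (K - n - 1)
      (cubeFam false (F.P K).L a M' ρ' (K - n)) (cubeLamS (F.P K).L a M' ρ' (K - n)) (cubeLamB (F.P K).L a M' ρ' (K - n)))
    (hα₀9 : ε₀ ≤ cB9) (hcs9 : cstar ≤ cB9)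
    -- SOCKET: the [4] LETTERS at `(K − n, U₀ := 1)` as ONE package (✓p654110's `SLetτ`; VERBATIM ✓p659785∕✓p660425's)
    (SLetτ : ∃ (g Δ : (LSite (F.P K).d → (Matrix (Fin 2) (Fin 2) ℂ)) →ₗ[ℂ] (LSite (F.P K).d → (Matrix (Fin 2) (Fin 2) ℂ))) (q : (LSite (F.P K).d → (Matrix (Fin 2) (Fin 2) ℂ)) →ₗ[ℂ] (ℕ → LSite (F.P K).d → (Matrix (Fin 2) (Fin 2) ℂ)))
        (qs : (ℕ → LSite (F.P K).d → (Matrix (Fin 2) (Fin 2) ℂ)) →ₗ[ℂ] (LSite (F.P K).d → (Matrix (Fin 2) (Fin 2) ℂ))) (Aw c : (ℕ → LSite (F.P K).d → (Matrix (Fin 2) (Fin 2) ℂ)) →ₗ[ℂ] (ℕ → LSite (F.P K).d → (Matrix (Fin 2) (Fin 2) ℂ)))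
        (H' : XSpace (F.P K).d (K - n) (Matrix (Fin 2) (Fin 2) ℂ) →ₗ[ℂ] (LSite (F.P K).d → (Matrix (Fin 2) (Fin 2) ℂ))),
      (∀ x, ∀ y ∈ (cubeFam false (F.P K).L a M' ρ' (K - n)) 0, (Δ (g x) + qs (Aw (q (g x)))) y = x y) ∧ (∀ f, q (g (g (qs (c (q f))))) = q f) ∧
      (∀ (f : LSite (F.P K).d → (Matrix (Fin 2) (Fin 2) ℂ)), ∀ x ∈ (cubeFam false (F.P K).L a M' ρ' (K - n)) 0, Δ f x = covLap (((F.L : ℝ)⁻¹) ^ (K - n)) (1 : LSite (F.P K).d → Fin (F.P K).d → (Matrix (Fin 2) (Fin 2) ℂ)ˣ) (((cubeFam false (F.P K).L a M' ρ' (K - n)) 0).indicator f) x) ∧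
      (∀ (μ : ℕ → LSite (F.P K).d → (Matrix (Fin 2) (Fin 2) ℂ)), ∀ x ∈ (cubeFam false (F.P K).L a M' ρ' (K - n)) 0, qs μ x = QT (F.P K).L (K - n) (cubeLamS (F.P K).L a M' ρ' (K - n) (K - n)) (1 : LSite (F.P K).d → Fin (F.P K).d → (Matrix (Fin 2) (Fin 2) ℂ)ˣ) μ x) ∧
      (∀ (f : LSite (F.P K).d → (Matrix (Fin 2) (Fin 2) ℂ)) (j : ℕ), j ≤ K - n → ∀ y ∈ (cubeLamS (F.P K).L a M' ρ' (K - n) (K - n)) j, q f j y = QprimeIter (zdBlocking (F.P K).d (F.P K).L) (bgT (F.P K).L (1 : LSite (F.P K).d → Fin (F.P K).d → (Matrix (Fin 2) (Fin 2) ℂ)ˣ)) j f y) ∧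
      (∀ (X : XSpace (F.P K).d (K - n) (Matrix (Fin 2) (Fin 2) ℂ)) (x : LSite (F.P K).d), ‖H' X x‖ ≤ B₀'H * ‖X‖) ∧
      (∀ j, j ≤ K - n → ∀ (X : XSpace (F.P K).d (K - n) (Matrix (Fin 2) (Fin 2) ℂ)), ∀ p ∈ {b : LSite (F.P K).d × Fin (F.P K).d | SideTouches ((cubeFam false (F.P K).L a M' ρ' (K - n)) j) b.1 b.2},
        wt (F.P K).L (((F.L : ℝ)⁻¹) ^ (K - n)) j * ‖covDerivFwd (((F.L : ℝ)⁻¹) ^ (K - n)) (1 : LSite (F.P K).d → Fin (F.P K).d → (Matrix (Fin 2) (Fin 2) ℂ)ˣ) p.2 (H' X) p.1‖ ≤ B₀'H * ‖X‖) ∧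
      (∀ X : XSpace (F.P K).d (K - n) (Matrix (Fin 2) (Fin 2) ℂ), Bd2 (F.P K).L (((F.L : ℝ)⁻¹) ^ (K - n)) (K - n) (cubeFam false (F.P K).L a M' ρ' (K - n)) (covLap (((F.L : ℝ)⁻¹) ^ (K - n)) (1 : LSite (F.P K).d → Fin (F.P K).d → (Matrix (Fin 2) (Fin 2) ℂ)ˣ) (H' X)) (B₂' * ‖X‖)) ∧
      (∀ (X : XSpace (F.P K).d (K - n) (Matrix (Fin 2) (Fin 2) ℂ)) (x : LSite (F.P K).d), x ∉ (cubeFam false (F.P K).L a M' ρ' (K - n)) 0 → H' X x = 0) ∧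
      (∀ X Y : XSpace (F.P K).d (K - n) (Matrix (Fin 2) (Fin 2) ℂ), (∀ p, Y p = -star (X p)) → ∀ x, H' Y x = -star (H' X x)) ∧
      (∀ (Y : XSpace (F.P K).d (K - n) (Matrix (Fin 2) (Fin 2) ℂ)) (j : ℕ) (hj : j ≤ K - n) (y : LSite (F.P K).d), y ∈ (cubeLamS (F.P K).L a M' ρ' (K - n) (K - n)) j →
        QprimeIter (zdBlocking (F.P K).d (F.P K).L) (bgT (F.P K).L (1 : LSite (F.P K).d → Fin (F.P K).d → (Matrix (Fin 2) (Fin 2) ℂ)ˣ)) j (H' Y) y = Y (⟨j, Nat.lt_succ_of_le hj⟩, y)) ∧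
      (∀ (f : LSite (F.P K).d → (Matrix (Fin 2) (Fin 2) ℂ)) (r : ℝ), 0 ≤ r → Bd2 (F.P K).L (((F.L : ℝ)⁻¹) ^ (K - n)) (K - n) (cubeFam false (F.P K).L a M' ρ' (K - n)) f r →
        (∀ x, ‖g f x‖ ≤ BG * r) ∧ ∀ j, j ≤ K - n → ∀ p ∈ {b : LSite (F.P K).d × Fin (F.P K).d | SideTouches ((cubeFam false (F.P K).L a M' ρ' (K - n)) j) b.1 b.2},
          wt (F.P K).L (((F.L : ℝ)⁻¹) ^ (K - n)) j * ‖covDerivFwd (((F.L : ℝ)⁻¹) ^ (K - n)) (1 : LSite (F.P K).d → Fin (F.P K).d → (Matrix (Fin 2) (Fin 2) ℂ)ˣ) p.2 (g f) p.1‖ ≤ BG * r) ∧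
      (∀ (f : LSite (F.P K).d → (Matrix (Fin 2) (Fin 2) ℂ)) (x : LSite (F.P K).d), x ∉ (cubeFam false (F.P K).L a M' ρ' (K - n)) 0 → g f x = 0) ∧
      (∀ f : LSite (F.P K).d → (Matrix (Fin 2) (Fin 2) ℂ), (∀ j, j ≤ K - n → ∀ x ∈ (cubeFam false (F.P K).L a M' ρ' (K - n)) j, IsSelfAdjoint (f x)) → ∀ x, IsSelfAdjoint (g f x)) ∧
      (∀ (f : LSite (F.P K).d → (Matrix (Fin 2) (Fin 2) ℂ)) (r : ℝ), 0 ≤ r → Bd2 (F.P K).L (((F.L : ℝ)⁻¹) ^ (K - n)) (K - n) (cubeFam false (F.P K).L a M' ρ' (K - n)) f r → Bd2 (F.P K).L (((F.L : ℝ)⁻¹) ^ (K - n)) (K - n) (cubeFam false (F.P K).L a M' ρ' (K - n)) (f - g (qs (c (q (g f))))) (BR * r)) ∧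
      (∀ f : LSite (F.P K).d → (Matrix (Fin 2) (Fin 2) ℂ), (∀ j, j ≤ K - n → ∀ x ∈ (cubeFam false (F.P K).L a M' ρ' (K - n)) j, IsSelfAdjoint (f x)) → ∀ j, j ≤ K - n → ∀ x ∈ (cubeFam false (F.P K).L a M' ρ' (K - n)) j, IsSelfAdjoint ((f - g (qs (c (q (g f))))) x)) ∧
      (∀ X : XSpace (F.P K).d (K - n) (Matrix (Fin 2) (Fin 2) ℂ), (∀ p, trCLM (Fin 2) (X p) = 0) → ∀ x, trCLM (Fin 2) (H' X x) = 0) ∧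
      (∀ f : LSite (F.P K).d → (Matrix (Fin 2) (Fin 2) ℂ), (∀ j, j ≤ K - n → ∀ x ∈ (cubeFam false (F.P K).L a M' ρ' (K - n)) j, trCLM (Fin 2) (f x) = 0) → ∀ x, trCLM (Fin 2) (g f x) = 0) ∧
      (∀ f : LSite (F.P K).d → (Matrix (Fin 2) (Fin 2) ℂ), (∀ j, j ≤ K - n → ∀ x ∈ (cubeFam false (F.P K).L a M' ρ' (K - n)) j, trCLM (Fin 2) (f x) = 0) → ∀ j, j ≤ K - n → ∀ x ∈ (cubeFam false (F.P K).L a M' ρ' (K - n)) j, trCLM (Fin 2) ((f - g (qs (c (q (g f))))) x) = 0))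
    -- SOCKETS: ✓p654113's (1.42) and (1.59) at the knit clause, ∀-closed over the member's `SU(2)` gauge and the top-knit gauge `g′` (VERBATIM ✓p660425's)
    (H42 : ∀ (gJ : GaugeTransf (F.P K) 0 (Matrix.specialUnitaryGroup (Fin 2) ℂ)),
      InAk (F.P K).L (K - n) (((F.L : ℝ)⁻¹) ^ (K - n)) ε₀ (fun _ => (Set.univ : Set (LSite (F.P K).d))) (pull (unitsField (toUField (GaugeField.gaugeAct gJ U))) 0) →
      (∀ m', m' ≤ K - n → ∀ Λ : ℕ → Set (LSite (F.P K).d), InAx (F.P K).L m' Λ (1 : LSite (F.P K).d → Fin (F.P K).d → (Matrix (Fin 2) (Fin 2) ℂ)ˣ) (pull (unitsField (toUField (GaugeField.gaugeAct gJ U))) 0)) →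
      ∀ (g' : GaugeTransf (F.P K) 0 (Matrix (Fin 2) (Fin 2) ℂ)ˣ) (u : LSite (F.P K).d → (Matrix (Fin 2) (Fin 2) ℂ)ˣ) (V' : LSite (F.P K).d → Fin (F.P K).d → (Matrix (Fin 2) (Fin 2) ℂ)ˣ)
        (A' : LSite (F.P K).d → Fin (F.P K).d → (Matrix (Fin 2) (Fin 2) ℂ)),
      (∀ x, u x ∈ unitaryUnits (Matrix (Fin 2) (Fin 2) ℂ)) → mgauge (1 : LSite (F.P K).d → Fin (F.P K).d → (Matrix (Fin 2) (Fin 2) ℂ)ˣ) u V' = (pull (unitsField (toUField (GaugeField.gaugeAct gJ U))) 0) →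
      Restr129 (F.P K).L (K - n) (Function.update (cubeLamS (F.P K).L a M' ρ' (K - n) (K - n)) (K - n) ∅) (1 : LSite (F.P K).d → Fin (F.P K).d → (Matrix (Fin 2) (Fin 2) ℂ)ˣ) u →
      (IsLandau138W (F.P K).L (K - n) (((F.L : ℝ)⁻¹) ^ (K - n)) ((cubeFam false (F.P K).L a M' ρ' (K - n)) 0) (cubeLamS (F.P K).L a M' ρ' (K - n) (K - n)) (1 : LSite (F.P K).d → Fin (F.P K).d → (Matrix (Fin 2) (Fin 2) ℂ)ˣ) V' ∧
        (∀ c ∈ (cubeLamB (F.P K).L a M' ρ' (K - n) (K - n)) (K - n), ∀ (y : LSite (F.P K).d) (τ : Fin (F.P K).d),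
          InBox (loK (F.P K).L (K - n) c.1) (bondHiK (F.P K).L (K - n) c.1 c.2) y → InBox (loK (F.P K).L (K - n) c.1) (bondHiK (F.P K).L (K - n) c.1 c.2) (y + e τ) →
          V' y τ = gaugeActT g' (unitsField (toUField U)) ⟨cover (F.P K) y, τ⟩)) →
      (∀ y τ, IsSelfAdjoint (A' y τ)) →
      (∀ j, j ≤ K - n → ∀ y τ, SideTouches ((cubeFam false (F.P K).L a M' ρ' (K - n)) j) y τ →
        V' y τ = cfgExp (((F.L : ℝ)⁻¹) ^ (K - n)) A' y τ ∧ ‖A' y τ‖ ≤ (2 * ((F.P K).L * cstar) + 8 * α₄) * (((F.P K).L : ℝ) ^ j * (((F.L : ℝ)⁻¹) ^ (K - n)))⁻¹) →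
      (∀ y τ, (∀ j, j ≤ K - n → ¬ SideTouches ((cubeFam false (F.P K).L a M' ρ' (K - n)) j) y τ) → A' y τ = 0) →
      ∀ j, j ≤ K - n → ∀ c ∈ (cubeLamB (F.P K).L a M' ρ' (K - n) (K - n)) j, ‖logCovIter (F.P K).L (1 : LSite (F.P K).d → Fin (F.P K).d → (Matrix (Fin 2) (Fin 2) ℂ)ˣ) (iEta (((F.L : ℝ)⁻¹) ^ (K - n)) A') j c.1 c.2‖ < 2 * (F.P K).d * (F.P K).L * α₁)
    (H59 : ∀ (gJ : GaugeTransf (F.P K) 0 (Matrix.specialUnitaryGroup (Fin 2) ℂ)),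
      InAk (F.P K).L (K - n) (((F.L : ℝ)⁻¹) ^ (K - n)) ε₀ (fun _ => (Set.univ : Set (LSite (F.P K).d))) (pull (unitsField (toUField (GaugeField.gaugeAct gJ U))) 0) →
      (∀ m', m' ≤ K - n → ∀ Λ : ℕ → Set (LSite (F.P K).d), InAx (F.P K).L m' Λ (1 : LSite (F.P K).d → Fin (F.P K).d → (Matrix (Fin 2) (Fin 2) ℂ)ˣ) (pull (unitsField (toUField (GaugeField.gaugeAct gJ U))) 0)) →
      ∀ (g' : GaugeTransf (F.P K) 0 (Matrix (Fin 2) (Fin 2) ℂ)ˣ) (u : LSite (F.P K).d → (Matrix (Fin 2) (Fin 2) ℂ)ˣ) (V' : LSite (F.P K).d → Fin (F.P K).d → (Matrix (Fin 2) (Fin 2) ℂ)ˣ)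
        (A' : LSite (F.P K).d → Fin (F.P K).d → (Matrix (Fin 2) (Fin 2) ℂ)),
      (∀ x, u x ∈ unitaryUnits (Matrix (Fin 2) (Fin 2) ℂ)) → mgauge (1 : LSite (F.P K).d → Fin (F.P K).d → (Matrix (Fin 2) (Fin 2) ℂ)ˣ) u V' = (pull (unitsField (toUField (GaugeField.gaugeAct gJ U))) 0) →
      Restr129 (F.P K).L (K - n) (Function.update (cubeLamS (F.P K).L a M' ρ' (K - n) (K - n)) (K - n) ∅) (1 : LSite (F.P K).d → Fin (F.P K).d → (Matrix (Fin 2) (Fin 2) ℂ)ˣ) u →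
      (IsLandau138W (F.P K).L (K - n) (((F.L : ℝ)⁻¹) ^ (K - n)) ((cubeFam false (F.P K).L a M' ρ' (K - n)) 0) (cubeLamS (F.P K).L a M' ρ' (K - n) (K - n)) (1 : LSite (F.P K).d → Fin (F.P K).d → (Matrix (Fin 2) (Fin 2) ℂ)ˣ) V' ∧
        (∀ c ∈ (cubeLamB (F.P K).L a M' ρ' (K - n) (K - n)) (K - n), ∀ (y : LSite (F.P K).d) (τ : Fin (F.P K).d),
          InBox (loK (F.P K).L (K - n) c.1) (bondHiK (F.P K).L (K - n) c.1 c.2) y → InBox (loK (F.P K).L (K - n) c.1) (bondHiK (F.P K).L (K - n) c.1 c.2) (y + e τ) →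
          V' y τ = gaugeActT g' (unitsField (toUField U)) ⟨cover (F.P K) y, τ⟩)) →
      (∀ y τ, IsSelfAdjoint (A' y τ)) →
      (∀ j, j ≤ K - n → ∀ y τ, SideTouches ((cubeFam false (F.P K).L a M' ρ' (K - n)) j) y τ →
        V' y τ = cfgExp (((F.L : ℝ)⁻¹) ^ (K - n)) A' y τ ∧ ‖A' y τ‖ ≤ (2 * ((F.P K).L * cstar) + 8 * α₄) * (((F.P K).L : ℝ) ^ j * (((F.L : ℝ)⁻¹) ^ (K - n)))⁻¹) →
      (∀ y τ, (∀ j, j ≤ K - n → ¬ SideTouches ((cubeFam false (F.P K).L a M' ρ' (K - n)) j) y τ) → A' y τ = 0) →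
      msup (F.P K).L (K - n) (((F.L : ℝ)⁻¹) ^ (K - n)) (-(1 : ℝ)) (fun j (b : LSite (F.P K).d × Fin (F.P K).d) => SideTouches ((cubeFam false (F.P K).L a M' ρ' (K - n)) j) b.1 b.2) (fun b => A' b.1 b.2)
          ≤ B₀ * (bondNorm (F.P K).L (K - n) (((F.L : ℝ)⁻¹) ^ (K - n)) (-(3 : ℝ)) (cubeFam false (F.P K).L a M' ρ' (K - n)) (fun x μ => Jcur (((F.L : ℝ)⁻¹) ^ (K - n)) (1 : LSite (F.P K).d → Fin (F.P K).d → (Matrix (Fin 2) (Fin 2) ℂ)ˣ) A' μ x)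
            + wsup 1 (fun p : {p : ℕ × (LSite (F.P K).d × Fin (F.P K).d) // p.1 ≤ K - n ∧ p.2 ∈ (cubeLamB (F.P K).L a M' ρ' (K - n) (K - n)) p.1} =>
                linCovIter (F.P K).L (1 : LSite (F.P K).d → Fin (F.P K).d → (Matrix (Fin 2) (Fin 2) ℂ)ˣ) (iEta (((F.L : ℝ)⁻¹) ^ (K - n)) A') p.1.1 p.1.2.1 p.1.2.2)) ∧
        msup (F.P K).L (K - n) (((F.L : ℝ)⁻¹) ^ (K - n)) (-(2 : ℝ)) (fun j (t : Fin (F.P K).d × Fin (F.P K).d × LSite (F.P K).d) => SideTouches ((cubeFam false (F.P K).L a M' ρ' (K - n)) j) t.2.2 t.2.1)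
            (fun t => covDerivFwd (((F.L : ℝ)⁻¹) ^ (K - n)) (1 : LSite (F.P K).d → Fin (F.P K).d → (Matrix (Fin 2) (Fin 2) ℂ)ˣ) t.1 (fun z => A' z t.2.1) t.2.2)
          ≤ B₀ * (bondNorm (F.P K).L (K - n) (((F.L : ℝ)⁻¹) ^ (K - n)) (-(3 : ℝ)) (cubeFam false (F.P K).L a M' ρ' (K - n)) (fun x μ => Jcur (((F.L : ℝ)⁻¹) ^ (K - n)) (1 : LSite (F.P K).d → Fin (F.P K).d → (Matrix (Fin 2) (Fin 2) ℂ)ˣ) A' μ x)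
            + wsup 1 (fun p : {p : ℕ × (LSite (F.P K).d × Fin (F.P K).d) // p.1 ≤ K - n ∧ p.2 ∈ (cubeLamB (F.P K).L a M' ρ' (K - n) (K - n)) p.1} =>
                linCovIter (F.P K).L (1 : LSite (F.P K).d → Fin (F.P K).d → (Matrix (Fin 2) (Fin 2) ℂ)ˣ) (iEta (((F.L : ℝ)⁻¹) ^ (K - n)) A') p.1.1 p.1.2.1 p.1.2.2))) :
              ∃ (t : ℤ) (_ : 0 ≤ t) (_ : t ≤ (M' : ℤ) - 1)
                (gJ : GaugeTransf (F.P K) 0 (Matrix.specialUnitaryGroup (Fin 2) ℂ))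
                (u₁ : LSite (F.P K).d → (Matrix (Fin 2) (Fin 2) ℂ)ˣ)
                (W : LSite (F.P K).d → Fin (F.P K).d → (Matrix (Fin 2) (Fin 2) ℂ)ˣ)
                (A : LSite (F.P K).d → Fin (F.P K).d → Matrix (Fin 2) (Fin 2) ℂ)
                (c₁ c' : ℝ)
                (κf : (Site (F.P K) 0 → Matrix (Fin 2) (Fin 2) ℂ) → (i : ℕ) → GaugeTransf (F.P K) i (Matrix (Fin 2) (Fin 2) ℂ)ˣ)
                (lam : LSite (F.P K).d → Matrix (Fin 2) (Fin 2) ℂ)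
                (α₄ cA : ℝ),
                (∀ z, ((u₁ z : (Matrix (Fin 2) (Fin 2) ℂ)ˣ) : Matrix (Fin 2) (Fin 2) ℂ) ∈ Matrix.specialUnitaryGroup (Fin 2) ℂ) ∧
                (mgauge (1 : LSite (F.P K).d → Fin (F.P K).d → (Matrix (Fin 2) (Fin 2) ℂ)ˣ) u₁ W = pull (unitsField (toUField (GaugeField.gaugeAct gJ U))) 0) ∧
                (∀ b ∈ {b : LSite (F.P K).d × Fin (F.P K).d | SideTouches (cubeFam false (F.P K).L (fun μ => ((iterBlockOf (K - n) x₀ μ).val : ℤ) - t) M' (ρ + M + L + S) (K - n) 0) b.1 b.2},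
      W b.1 b.2 = cfgExp (((F.L : ℝ)⁻¹) ^ (K - n)) A b.1 b.2) ∧
                (0 ≤ c') ∧
                (8 * 3800 * ((((F.P K).d + 2) * (F.P K).L : ℕ) : ℝ) ^ 2 * c' ≤ 1) ∧
                (Real.exp c₁ - 1 ≤ ((F.L : ℝ)⁻¹) ^ (K - n) * c') ∧
                (∀ z ∈ cube (F.P K).L (fun μ => ((iterBlockOf (K - n) x₀ μ).val : ℤ) - t) M' (ρ + M + L + S) (K - n) (K - n), ∀ ν : Fin (F.P K).d,
      W z ν = cfgExp (((F.L : ℝ)⁻¹) ^ (K - n)) A z ν ∧ ((F.L : ℝ)⁻¹) ^ (K - n) * ‖A z ν‖ ≤ c₁) ∧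
                (∀ (m : Site (F.P K) 0 → Matrix (Fin 2) (Fin 2) ℂ) (i : ℕ) (y : Site (F.P K) (i + 1)),
      κf m (i + 1) y = (vframeU (gaugeActT (κf m i) (dbarIterU i (gaugeActT
        (fun s => (u₁ (lift (F.P K) x₀ + rel x₀ s))⁻¹ * Unitary.toUnits (suIncl (gJ s)) : GaugeTransf (F.P K) 0 (Matrix (Fin 2) (Fin 2) ℂ)ˣ)
        (unitsField (toUField U))))) y)⁻¹ * κf m i (emb y) *
        vframeU (dbarIterU i (gaugeActT
          (fun s => (u₁ (lift (F.P K) x₀ + rel x₀ s))⁻¹ * Unitary.toUnits (suIncl (gJ s)) : GaugeTransf (F.P K) 0 (Matrix (Fin 2) (Fin 2) ℂ)ˣ)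
          (unitsField (toUField U)))) y) ∧
                (∀ (m : Site (F.P K) 0 → Matrix (Fin 2) (Fin 2) ℂ) (x : Site (F.P K) 0), ((κf m 0 x : (Matrix (Fin 2) (Fin 2) ℂ)ˣ) : Matrix (Fin 2) (Fin 2) ℂ) = exp (m x)) ∧
                (0 ≤ α₄) ∧
                (α₄ ≤ 1 / 70) ∧
                (0 ≤ cA) ∧
                (cA ≤ 1 / 12) ∧
                (∀ x, IsSelfAdjoint (lam x)) ∧
                (∀ x, (lam x).trace = 0) ∧
                (∀ x, x ∉ cubeFam false (F.P K).L (fun μ => ((iterBlockOf (K - n) x₀ μ).val : ℤ) - t) M' (ρ + M + L + S) (K - n) 0 → lam x = 0) ∧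
                (∀ b ∈ {b : LSite (F.P K).d × Fin (F.P K).d | SideTouches (cubeFam false (F.P K).L (fun μ => ((iterBlockOf (K - n) x₀ μ).val : ℤ) - t) M' (ρ + M + L + S) (K - n) 0) b.1 b.2},
      ‖lam b.1‖ ≤ α₄ ∧ wt (F.P K).L (((F.L : ℝ)⁻¹) ^ (K - n)) 0 *
        ‖covDerivFwd (((F.L : ℝ)⁻¹) ^ (K - n)) (1 : LSite (F.P K).d → Fin (F.P K).d → (Matrix (Fin 2) (Fin 2) ℂ)ˣ) b.2 lam b.1‖ ≤ α₄) ∧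
                (∃ μ : ℕ → LSite (F.P K).d → Matrix (Fin 2) (Fin 2) ℂ, ∀ x ∈ cubeFam false (F.P K).L (fun μ => ((iterBlockOf (K - n) x₀ μ).val : ℤ) - t) M' (ρ + M + L + S) (K - n) 0,
      covLap (((F.L : ℝ)⁻¹) ^ (K - n)) (1 : LSite (F.P K).d → Fin (F.P K).d → (Matrix (Fin 2) (Fin 2) ℂ)ˣ)
        ((cubeFam false (F.P K).L (fun μ => ((iterBlockOf (K - n) x₀ μ).val : ℤ) - t) M' (ρ + M + L + S) (K - n) 0).indicator fun y =>
          covDivB (((F.L : ℝ)⁻¹) ^ (K - n)) (1 : LSite (F.P K).d → Fin (F.P K).d → (Matrix (Fin 2) (Fin 2) ℂ)ˣ) A y +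
          covLap (((F.L : ℝ)⁻¹) ^ (K - n)) (1 : LSite (F.P K).d → Fin (F.P K).d → (Matrix (Fin 2) (Fin 2) ℂ)ˣ) lam y +
          ((conjR (gaugeExp lam y)⁻¹ (covDivB (((F.L : ℝ)⁻¹) ^ (K - n)) (1 : LSite (F.P K).d → Fin (F.P K).d → (Matrix (Fin 2) (Fin 2) ℂ)ˣ) A y) -
              covDivB (((F.L : ℝ)⁻¹) ^ (K - n)) (1 : LSite (F.P K).d → Fin (F.P K).d → (Matrix (Fin 2) (Fin 2) ℂ)ˣ) A y) +
            (gAd (covLap (((F.L : ℝ)⁻¹) ^ (K - n)) (1 : LSite (F.P K).d → Fin (F.P K).d → (Matrix (Fin 2) (Fin 2) ℂ)ˣ) lam y) (lam y) -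
              covLap (((F.L : ℝ)⁻¹) ^ (K - n)) (1 : LSite (F.P K).d → Fin (F.P K).d → (Matrix (Fin 2) (Fin 2) ℂ)ˣ) lam y) +
            ∑ μ, frakF3 (((F.L : ℝ)⁻¹) ^ (K - n)) (1 : LSite (F.P K).d → Fin (F.P K).d → (Matrix (Fin 2) (Fin 2) ℂ)ˣ) lam A y μ)) x =
        QT (F.P K).L (K - n) (cubeLamS (F.P K).L (fun μ => ((iterBlockOf (K - n) x₀ μ).val : ℤ) - t) M' (ρ + M + L + S) (K - n) (K - n)) (1 : LSite (F.P K).d → Fin (F.P K).d → (Matrix (Fin 2) (Fin 2) ℂ)ˣ) μ x) ∧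
                (∀ yc ∈ cubeLamS (F.P K).L (fun μ => ((iterBlockOf (K - n) x₀ μ).val : ℤ) - t) M' (ρ + M + L + S) (K - n) (K - n) (K - n),
      κf (((-I) • lam) ∘ fun s : Site (F.P K) 0 => lift (F.P K) x₀ + rel x₀ s) (K - n) (coverAt (F.P K) (K - n) yc) =
        axialT (dbarIterU (K - n) (gaugeActT
          (fun s => (u₁ (lift (F.P K) x₀ + rel x₀ s))⁻¹ * Unitary.toUnits (suIncl (gJ s)) : GaugeTransf (F.P K) 0 (Matrix (Fin 2) (Fin 2) ℂ)ˣ)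
          (unitsField (toUField U)))) (iterBlockOf (K - n) x₀) (coverAt (F.P K) (K - n) yc)) ∧
                (∀ x ∈ cubeFam false (F.P K).L (fun μ => ((iterBlockOf (K - n) x₀ μ).val : ℤ) - t) M' (ρ + M + L + S) (K - n) 0, ∀ μ : Fin (F.P K).d,
      wt (F.P K).L (((F.L : ℝ)⁻¹) ^ (K - n)) 0 * ‖A x μ‖ ≤ cA ∧
        wt (F.P K).L (((F.L : ℝ)⁻¹) ^ (K - n)) 0 *
          ‖conjR ((1 : LSite (F.P K).d → Fin (F.P K).d → (Matrix (Fin 2) (Fin 2) ℂ)ˣ) (x - e μ) μ)⁻¹ (A (x - e μ) μ)‖ ≤ cA) ∧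
                (∀ j, j ≤ K - n → ∀ z ∈ cube (F.P K).L (fun μ => ((iterBlockOf (K - n) x₀ μ).val : ℤ) - t) M' (ρ + M + L + S) (K - n) j, ∀ ν' : Fin (F.P K).d,
      (F.L : ℝ) ^ j * ((F.L : ℝ)⁻¹) ^ (K - n) *
        ‖logCfg (((F.L : ℝ)⁻¹) ^ (K - n)) (mgauge (1 : LSite (F.P K).d → Fin (F.P K).d → (Matrix (Fin 2) (Fin 2) ℂ)ˣ) (gaugeExp lam)⁻¹
          (cfgExp (((F.L : ℝ)⁻¹) ^ (K - n)) A)) z ν'‖ ≤ Bsz * ε₀) ∧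
                (∀ j, j ≤ K - n → ∀ z ∈ cube (F.P K).L (fun μ => ((iterBlockOf (K - n) x₀ μ).val : ℤ) - t) M' (ρ + M + L + S) (K - n) j, ∀ ν' μ' : Fin (F.P K).d,
      z + e μ' ∈ cube (F.P K).L (fun μ => ((iterBlockOf (K - n) x₀ μ).val : ℤ) - t) M' (ρ + M + L + S) (K - n) 0 →
      ((F.L : ℝ) ^ j * ((F.L : ℝ)⁻¹) ^ (K - n)) ^ 2 * (F.L : ℝ) ^ (K - n) *
        ‖logCfg (((F.L : ℝ)⁻¹) ^ (K - n)) (mgauge (1 : LSite (F.P K).d → Fin (F.P K).d → (Matrix (Fin 2) (Fin 2) ℂ)ˣ) (gaugeExp lam)⁻¹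
            (cfgExp (((F.L : ℝ)⁻¹) ^ (K - n)) A)) (z + e μ') ν' -
          logCfg (((F.L : ℝ)⁻¹) ^ (K - n)) (mgauge (1 : LSite (F.P K).d → Fin (F.P K).d → (Matrix (Fin 2) (Fin 2) ℂ)ˣ) (gaugeExp lam)⁻¹
            (cfgExp (((F.L : ℝ)⁻¹) ^ (K - n)) A)) z ν'‖ ≤ Bsz * ε₀) := by
  classical
  letI : CStarAlgebra (Matrix (Fin 2) (Fin 2) ℂ) := B10Eq29TubeLine.cstarAlgebraMatrix 2
  -- FILE A₂: the datum; FILE A₂′: the top step's nine rows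
  have hcs16 : cstar ≤ 1 / 16 := by
    have hL2r : (2 : ℝ) ≤ (F.P K).L := by exact_mod_cast (F.P K).hL.2
    have hcs0 : 0 ≤ cstar := by rw [hc]; positivity
    have h2 : 2 * cstar ≤ (F.P K).L * cstar := mul_le_mul_of_nonneg_right hL2r hcs0
    linarith only [h2, hs₂]
  obtain ⟨gJ, u₁, W, A, κf, hInAk, hInAx, htw, hu₁SU, h129, hW, hLan, hdat, hAτ, hκfs, hκf0⟩ :=
    siteDatum_of_T4 F L hF hnK h2 ρ S M M' hρ'def hε₀ hε hsdef hs6 hroom V U hU x₀ ht0 ht hadef hcs16 hT4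
  obtain ⟨lam, hsa, hsupp, hτ0, h108, hmult, hlo, htopId, hA0⟩ :=
    siteTop_of_datum F L hF hnK h2 ρ S M M' hρ'def hε₀ hroom U x₀ ht0 ht hadef hα₁ hB₀ hB₀' hsα₁ hc hα₄ hs₂ hside₀ hC₂ h61₀ hsmall₁
      hcBlo hcAlo hcDAlo hα3 hα4 hsmall hc₃ hsc hα₃' hs₁ hs₂' hs₃ hs₄ hs₅ hs₆ hs₇ hprod8 hcA13 hCblo hCllo hCbρ hClB hB₀'H hB₂' hBG hBR
      hσ hδ hω hτ₀ hbudget hm hm₀ hr hCb₀ hCl₀ hwin SB9 hα₀9 hcs9 SLetτ gJ u₁ W A κf hInAk hInAx htw hu₁SU h129 hW hLan hdat hAτ hκfs hκf0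
  subst hadef hρ'def
  -- letters of the member
  have hd3 : (F.P K).d = 3 := T3Family.P_d F K
  have hd2 : 2 ≤ (F.P K).d := by rw [hd3]; norm_num
  have hL2 : 2 ≤ (F.P K).L := (F.P K).hL.2
  have hL1 : 1 ≤ (F.P K).L := le_trans (by norm_num) hL2
  have hLF : (F.P K).L = F.L := rfl
  have hL0 : (0 : ℝ) < F.L := by exact_mod_cast (F.P K).L_pos
  have hLr1 : (1 : ℝ) ≤ (F.P K).L := by exact_mod_cast hL1
  have hη : 0 < (((F.L : ℝ)⁻¹) ^ (K - n)) := by positivity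
  have hρL : (F.P K).L ≤ ρ + M + L + S := by rw [hLF, hF]; omega
  have hεα : 0 < ε₀ + α₁ := add_pos hε₀ hα₁
  have hcs0 : 0 ≤ cstar := by rw [hc]; positivity
  have hα₄pos : 0 < α₄ := by rw [hα₄]; positivity
  have ha := corner_of_offset x₀ (K - n) (M' := M') ht0 ht
  obtain ⟨hroomW, -, -⟩ := HalvingHSiteDatumOfSockets.member_windows F L hF hnK ρ S M M' (ε₀ := ε₀) hroom x₀ ht0 ht
  -- the level letter `m := K − n − 1 ≥ 1`
  obtain ⟨m, hkm⟩ : ∃ m, K - n = m + 1 := ⟨K - n - 1, by omega⟩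
  have hmK : K - n - 1 = m := by omega
  have hηm : 0 < ((F.L : ℝ)⁻¹) ^ (m + 1) := by positivity
  rw [hmK] at hdat hAτ h129 hLan
  -- hMember's letters from the datum: the trace of `λ′`, the chart on the touched sides of `□₀`, the chart-with-size on `□_k`, `c₁`, `c′`
  have htr : ∀ x, (lam x).trace = 0 := fun x => by rw [← trCLM_apply]; exact hτ0 x
  have hchart₀ : ∀ b ∈ {b : LSite (F.P K).d × Fin (F.P K).d |
        SideTouches (cubeFam false (F.P K).L (fun μ => ((iterBlockOf (K - n) x₀ μ).val : ℤ) - t) M' (ρ + M + L + S) (K - n) 0) b.1 b.2},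
      W b.1 b.2 = cfgExp (((F.L : ℝ)⁻¹) ^ (K - n)) A b.1 b.2 :=
    fun b hb => (hdat 0 (Nat.zero_le _) b hb).1
  have hdat' := hdat
  rw [hkm] at hdat'
  have hchartTopm := hchartTop_of_hdat (𝔸 := Matrix (Fin 2) (Fin 2) ℂ) hd2 _ M' (ρ + M + L + S) m hηm hdat'
  have hchartTop : ∀ z ∈ cube (F.P K).L (fun μ => ((iterBlockOf (K - n) x₀ μ).val : ℤ) - t) M' (ρ + M + L + S) (K - n) (K - n), ∀ ν : Fin (F.P K).d,
      W z ν = cfgExp (((F.L : ℝ)⁻¹) ^ (K - n)) A z ν ∧ (((F.L : ℝ)⁻¹) ^ (K - n)) * ‖A z ν‖ ≤ cstar * (((F.P K).L : ℝ) ^ m)⁻¹ := by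
    rw [hkm]; exact hchartTopm
  have hcsm1 : cstar * (((F.P K).L : ℝ) ^ m)⁻¹ ≤ 1 := by
    have h1 : (((F.P K).L : ℝ) ^ m)⁻¹ ≤ 1 := inv_le_one_of_one_le₀ (one_le_pow₀ hLr1)
    have h3 : cstar ≤ (F.P K).L * cstar := le_mul_of_one_le_left hcs0 hLr1
    calc cstar * (((F.P K).L : ℝ) ^ m)⁻¹ ≤ 1 * 1 := mul_le_mul (by linarith only [h3, hs₂]) h1 (by positivity) (by norm_num)
      _ = 1 := one_mul _
  have hc₁ : Real.exp (cstar * (((F.P K).L : ℝ) ^ m)⁻¹) - 1 ≤ (((F.L : ℝ)⁻¹) ^ (K - n)) * (2 * (F.P K).L * cstar) := by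
    have h := hc₁_of_small hL1 m hcs0 hcsm1
    rw [hkm]; exact h
  have hbudget' : 8 * 3800 * ((((F.P K).d + 2) * (F.P K).L : ℕ) : ℝ) ^ 2 * (2 * (F.P K).L * cstar) ≤ 1 :=
    le_trans (mul_le_mul_of_nonneg_left hσ (by positivity)) hbudget
  -- the knit clause at the datum (✓p655738) and ✓p654113's two sockets at the top-knit gauge `g′ := ((u₁·e^{iλ′}) ∘ rep)⁻¹·ĝJ`
  have hu₁ : ∀ x, u₁ x ∈ unitaryUnits (Matrix (Fin 2) (Fin 2) ℂ) :=
    fun x => specialUnitaryUnits_le_unitaryUnits (mem_specialUnitaryUnits.2 (hu₁SU x))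
  have hU' : ∀ (x : LSite (F.P K).d) (κ : Fin (F.P K).d), pull (unitsField (toUField (GaugeField.gaugeAct gJ U))) 0 x κ ∈ unitaryUnits (Matrix (Fin 2) (Fin 2) ℂ) :=
    fun x κ => by rw [pull_apply]; exact unitsField_mem_unitaryUnits _ _
  have hknit := hknit_of_descent x₀ ha hroomW U gJ hu₁ hW hsa
  have H42' := H42 gJ hInAk hInAx (fun s => ((u₁ * gaugeExp lam) (lift (F.P K) x₀ + rel x₀ s))⁻¹ * Unitary.toUnits (suIncl (gJ s)))
  have H59' := H59 gJ hInAk hInAx (fun s => ((u₁ * gaugeExp lam) (lift (F.P K) x₀ + rel x₀ s))⁻¹ * Unitary.toUnits (suIncl (gJ s)))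
  have hηL : (((F.L : ℝ)⁻¹) ^ (m + 1))⁻¹ = ((F.P K).L : ℝ) ^ (m + 1) := by rw [hLF, inv_pow, inv_inv]
  -- transport to the callee's level letter `m + 1` (✓p654113 is lettered at `m + 1`)
  have hInAk' := hInAk
  have hInAx' := hInAx
  have h129' := h129
  have hsupp' := hsupp
  have h108' := h108
  have hmult' := hmult
  have hlo' := hlo
  have hA0' := hA0
  have hknit' := hknit
  have hsa' := hsa
  rw [hkm] at hInAk' hInAx' H42' H59' h129' hsupp' h108' hmult' hlo' hA0' hknit'
  -- THE SIZES at the member (✓p654113 at `m := K − n − 1`, `Bε := Bsz·ε₀`)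
  obtain ⟨hX1, hX2⟩ := siteSizeRows_of_topRows (𝔸 := Matrix (Fin 2) (Fin 2) ℂ) hd2 hηm hL2 (a := fun μ => ((iterBlockOf (m + 1) x₀ μ).val : ℤ) - t)
    (M' := M') hρL (m := m) rfl rfl rfl hU' hε₀ hα₁ hα₄pos hB₀ hc hInAk' hInAx'
    hα3 hα4 h16 hd5 hsmallP hc₃P hside h50 hC₂ h61 hcBlo hsmall hc₃ hsc hα₃' hs₁ hs₂' hs₃ hs₄ hs₅ hs₆ hprod8 _
    H42' H59' hu₁ hW h129' hdat' hα70 hcA0 hcA12 hsa hsupp' h108' hmult' hlo' hA0' hknit' hcsB hηL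
  refine ⟨t, ht0, ht, gJ, u₁, W, A, cstar * (((F.P K).L : ℝ) ^ m)⁻¹, 2 * (F.P K).L * cstar, κf, lam, α₄, cA,
    hu₁SU, hW, hchart₀, by positivity, hbudget', hc₁, hchartTop, hκfs, hκf0, hα₄pos.le, hα70, hcA0, hcA12, hsa, htr, hsupp,
    h108 0 (Nat.zero_le _), hmult, htopId, hA0, ?_, ?_⟩
  · rw [hkm]; exact hX1
  · rw [hkm]; exact hX2

end Summit.QuantumFields.YangMills.Theorems.HalvingHSiteRowsOfSockets

end
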